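import Literature.MathematicalPhysics.QuantumLattice.HardCoreBosonRepulsionInfiniteVolumeGroundStates
import Literature.MathematicalPhysics.QuantumLattice.HardCoreBosonRepulsionGroundStateUniqueTower
import HarnessLib

/-!
# The `U(1)` orbit of symmetry-breaking infinite-volume states of the planar XXZ antiferromagnet and of the
# interacting hard-core Bose gas on `ℤ^d` (Koma–Tasaki 1994, Corollary 2.9, in the infinitesimal-field realisation)

Topic `MathematicalPhysics/QuantumLattice`; family `hubbard` (cell `hubbard-cq`, transfer source «hard-core boson / XXZ»).
Sequel of `XXZInfiniteVolumeEquilibriumStates.lean` (every anisotropy `Δ`: Koma–Tasaki's infinitesimal-field states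
`lim_{B↓0} lim_Λ ⟨·⟩_{H_Λ − B O^α_Λ}` are infinite-volume ground states / dKMS states of `xxzLatticeInteraction`, with
the Dyson–Lieb–Simon / Kennedy–Lieb–Shastry floors `(-1)^x Re ω(Sˣ_x) ≥ √2σ`), of
`HardCoreBosonRepulsionInfiniteVolumeGroundStates.lean` (§1 there: site-dependent axial twists `ω ↦ ω ∘ Ad U_Θ` of
infinite-volume states, twist covariance of `InfVolState.IsGroundState`) and of
`XXZInfinitesimalFieldStatesMerminWagner.lean` (`d ≤ 2`, `T > 0`: these states have NO planar magnetisation).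

**What is printed.** Koma–Tasaki [KomaTasaki1994] Corollary 2.9: «For `0 ≤ θ < 2π`, define infinite volume states by
`ω_θ(⋯) := lim_k lim_Λ (e^{iθC} Ξ^{(k)}_Λ, (⋯) e^{iθC} Ξ^{(k)}_Λ)` … The states `ω_θ(⋯)` are infinite volume ground states.
They exhibit explicit symmetry breaking as `ω_θ(o^{(1)}_x) = m cos θ`, `ω_θ(o^{(2)}_x) = m sin θ`», obtained «by applying
the `U(1)` rotation `exp[iθC]`» (after Thm. 2.5) to one symmetry-breaking state; and Remark 2 of §2.4: the state
`ω̃(⋯) := lim_{B↓0} lim_Λ (Φ(B), (⋯)Φ(B))` with an infinitesimal symmetry-breaking field, «we expect that the state `ω̃`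
is identical to `ω_{θ=0}`». The tree realises the symmetry-breaking states by the FIELD route (KT93 (1.8);
`XXZKT.IsInfinitesimalFieldGroundState/ThermalState`); this file carries out Corollary 2.9 on them — the `U(1)`
rotation of an infinite-volume state being the uniform axial twist of the quasi-local algebra — at `T = 0` AND, with
Araki–Moriya's dKMS (energy–entropy balance) characterisation of equilibrium (`InfVolState.IsDKMSState`), at `T > 0`.

## Contents (everything PROVED; no definition, no named fact)

* §1 **Uniform axial rotations** `U_a = exp[-ia Σ_x (Ŝᶻ_x + S)] = twistOp (fun _ => a)` (general spin `S = n/2`):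
  `U_a Sˣ_x U_aᴴ = cos a Sˣ_x + sin a Sʸ_x`, `U_a Sʸ_x U_aᴴ = cos a Sʸ_x − sin a Sˣ_x`, `U_a Sᶻ_x U_aᴴ = Sᶻ_x`,
  `U_a S^±_x U_aᴴ = e^{∓ia} S^±_x` (`uniformTwist_conj_siteSpin_zero/one/two`, `uniformTwist_conj_onSite_spinRaise/Lower`);
  the planar exchange `Bˣ_{xy} + Bʸ_{xy}`, the XXZ bond, the XXZ Hamiltonian on any graph and the XXZ interaction on
  `ℤ^d` are `U(1)`-INVARIANT (`uniformTwist_conj_xxzBond`, `uniformTwist_conj_xxzHamiltonian`,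
  `uniformTwist_conj_xxzLatticeInteraction`); `U_{a+b} = U_aU_b`, `U_{2πk} = 𝟙`.
* §2 **Twist covariance of equilibrium**: `InfVolState.IsDKMSState.of_expect_eq_twist` — for twist-related interactions
  `Φ' Y = U_Y Φ Y U_Yᴴ` the twist `ω ↦ ω ∘ Ad U` maps dKMS states of `Φ'` at `β` to dKMS states of `Φ` at `β` (the thermal
  twin of the tree's `IsGroundState.of_expect_eq_twist`); hence uniform rotations map ground states / dKMS states of the
  XXZ interaction to ground states / dKMS states (`XXZKT.isGroundState_of_uniformTwist`, `XXZKT.isDKMSState_of_uniformTwist`);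
  and the CONVERSE OF SYMMETRY BREAKING: if the ground state (resp. the dKMS state at `β`) of the XXZ model on `ℤ^d` is
  UNIQUE it is `U(1)`-invariant, so EVERY charged local observable — `U_a A U_aᴴ = cA`, `c ≠ 1`: `S⁻_x = a_x`, `Sˣ_x`,
  `Sʸ_x`, `a_xa_y`, … — has zero expectation (`XXZKT.expect_eq_zero_of_hasUniqueGroundState`,
  `XXZKT.expect_eq_zero_of_dKMSState_unique`, `…_siteSpinAt_planar_eq_zero_…`): planar order FORCES non-uniqueness.
* §3 **The `x`-sourced states have no `y`- or `z`-moment**: the unitary `W = (half turn about y)·U_π` fixes `Sˣ`, reverses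
  `Sʸ`, `Sᶻ`, and fixes `H − B O^x`; so `⟨Sʸ_z⟩ = ⟨Sᶻ_z⟩ = 0` in the sourced Gibbs and ground states and
  `ω̃(Sʸ_x) = ω̃(Sᶻ_x) = 0` for every `x`-sourced infinitesimal-field state (KT93 (2.3)–(2.5) for the `x`-axis).
* §4 **THE `U(1)` ORBIT (antiferromagnet `J > 0`, planar regime `0 ≤ Δ ≤ 1`).**  `T = 0`, `d ≥ 2`, `(d, S) ≠ (2, ½)`
  (`XXZKT.xxzAF_groundStates_U1Orbit`): there are `m > 0` and infinite-volume ground states `ω_a`, `a ∈ ℝ`, of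
  `xxzLatticeInteraction d n J Δ` with `ω_a(Sˣ_x) = (-1)^x m cos a`, `ω_a(Sʸ_x) = (-1)^x m sin a`, `ω_a(Sᶻ_x) = 0` at every
  site, and `ω_a = ω_b ↔ b − a ∈ 2πℤ` — a CIRCLE of distinct ground states, the staggered planar order parameter pointing in
  every direction.  `T > 0`, `d ≥ 3`: `β₀ > 0` such that for every `β ≥ β₀` the same holds with dKMS states at `β`
  (`XXZKT.xxzAF_dKMSStates_U1Orbit`) — spontaneous breaking of the continuous `U(1)` symmetry in thermal equilibrium.
* §5 **THE INTERACTING HARD-CORE BOSE GAS / PLANAR FERROMAGNET** (`J < 0`, `-1 ≤ Δ ≤ 0`; bosons: hopping `t > 0`,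
  nearest-neighbour repulsion `0 ≤ V ≤ 2t`, `HardCoreBoson.hamiltonianNN_eq_xxzHamiltonian`): a circle of infinite-volume
  ground states `ω_a` with UNIFORM planar magnetisation `(m cos a, m sin a, 0)` (`XXZKT.xxzPlanarFerro_groundStates_U1Orbit`),
  i.e. Bose–Einstein condensates with every condensate phase, `ω_a(a†_x) = m e^{ia}`, `ω_a(a_x) = m e^{-ia}`, `m > 0`
  (`XXZKT.hardCoreBosonRepulsion_groundStates_condensatePhase`, `d ≥ 3`); and at `T > 0` (`d ≥ 3`, `β ≥ β₀`) a circle of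
  dKMS states of the Bose gas with `ω_a(a†_x) = m e^{ia}` (`XXZKT.hardCoreBosonRepulsion_dKMSStates_condensatePhase`) —
  Koma–Tasaki's «`ω_θ(a†_x) ≠ 0`» for the interacting gas, in equilibrium; and for `Δ ≤ -1` (bosons: `V ≥ 2t`) a dKMS state
  with staggered axial order / a density wave breaking the unit translations
  (`XXZKT.xxzPlanarFerro_exists_dKMSState_neelOrder`, `XXZKT.hardCoreBosonRepulsion_exists_dKMSState_solid`; general transfer
  `XXZKT.isDKMSState_neg_neg_of_sublatticeTwist`).

WHAT THIS IS NOT: extremality / purity / ergodicity of the `ω_a` is not claimed (KT94 conjecture it); `d = 2`, `S = ½`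
is excluded at `T = 0` and `d ≤ 2` at `T > 0` (Mermin–Wagner, `XXZInfinitesimalFieldStatesMerminWagner.lean`); the
identification `ω̃ = ω_{θ=0}` of the two constructions is KT94's expectation, not a theorem; nothing about the Hubbard model.

## Mathlib / tree search

`lean search 'uniformTwist|U1Orbit|cos a.*siteSpin|IsDKMSState.of_expect_eq_twist|condensatePhase'` (2026-08-29): nothing.
REUSED: `twistOp`, `twistOp_add`, `twistOp_eq_productOp`, `axialPhase_conj_spinRaise/Lower/spinZ`, `twistOp_conj_mul`,
`twistOp_conj_conjTranspose`, `twistOp_conj_embedOp`, `twistOp_conj_derivation`, `InfVolState.exists_twist`,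
`InfVolState.IsGroundState.of_expect_eq_twist`, `HasUniqueGroundState.expect_twist`, `sublatticeTwist_conj_siteSpin`,
`xxzLatticeInteraction_neg_neg_eq_twist_conj` (`HardCoreBosonRepulsionInfiniteVolumeGroundStates`); `productOp_conj_siteSpin`,
`productOp_conj_onSite`, `onSite_add'/sub'/smul'`; `XXZKT.halfTurnY*`, `XXZKT.gibbsState_conj_of_symmetry`,
`XXZKT.groundStateFunctional_conj_of_symmetry`, `XXZKT.IsInfinitesimalFieldState.expect_siteSpinAt_eq_zero`,
`XXZKT.xxzAF_infiniteVolume_(groundState_)spontaneousStaggeredMagnetisation`, `….isGroundState_xxz`, `….isDKMSState_xxz`,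
`….shift_eq_and_stagMagnetisation_eq`, `InfVolState.im_expect_eq_zero_of_isHermitian`, `HardCoreBoson.cre_eq/ann_eq`.

## References

* [KomaTasaki1994] T. Koma, H. Tasaki, *Symmetry breaking and finite-size effects in quantum many-body systems*,
  J. Stat. Phys. 76 (1994) 745–803 = arXiv:cond-mat/9708132: Corollary 2.9 (`ω_θ(o¹) = m cos θ`, `ω_θ(o²) = m sin θ`),
  the sentence after Theorem 2.5 («applying the `U(1)` rotation `exp[iθC]`»), §2.4 Remark 2 (`ω̃`), §3.3 (hard-core bosons,
  «the states `ω_θ` are really infinite volume ground states», `ω_θ(a†_x) = ω_θ(a_x)^* ≠ 0`).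
* [KomaTasaki1993] T. Koma, H. Tasaki, Commun. Math. Phys. 158 (1993) 191–214, §1 (1.8)–(1.10), §2 (2.3)–(2.5), §7 Thm. 7.3.
* [BratteliRobinsonII1997] O. Bratteli, D. W. Robinson, *Operator Algebras and Quantum Statistical Mechanics 2*, 2nd ed.
  (1997), §5.3.1 (KMS states and symmetries of the dynamics: `ω ∘ α` is KMS when `α` commutes with `τ_t`), Prop. 5.3.19,
  Thm. 6.2.4, §6.2.7.
* [ArakiMoriya2003] H. Araki, H. Moriya, Rev. Math. Phys. 15 (2003) 93, Def. 6.3 (dKMS), Thm. 6.4.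
* [Tasaki2022] H. Tasaki, *The Lieb–Schultz–Mattis theorem: a topological point of view*, arXiv:2202.06243, §3.1 (twists),
  before Cor. 3.6 (uniqueness ⇒ invariance).
* [Tasaki2020] H. Tasaki, *Physics and Mathematics of Quantum Many-Body Systems*, Springer (2020), §2.1 (2.1.6), (2.1.13).
* [DysonLiebSimon1978] F. J. Dyson, E. H. Lieb, B. Simon, J. Stat. Phys. 18 (1978) 335–383, Thm. 5.1, §2.
* [KennedyLiebShastryJSP1988] T. Kennedy, E. H. Lieb, B. S. Shastry, J. Stat. Phys. 53 (1988) 1019–1030, Theorem.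
* [MatsubaraMatsuda1956] T. Matsubara, H. Matsuda, Prog. Theor. Phys. 16 (1956) 569–582, §2.
-/

noncomputable section

open Matrix Complex Finset

namespace Literature.MathematicalPhysics.QuantumLattice

open Literature.Probability.LatticeModels _root_.Filter
open scoped ComplexOrder _root_.Topology

/-! ## §1 Uniform axial rotations of the quantum spin system -/

section Rotation

variable (n : ℕ)

/-- `e^{-ia} = cos a − i sin a` (real `a`). [cite: Tasaki2020, §2.1 eq. (2.1.13)] -/
theorem exp_neg_I_mul_ofReal (a : ℝ) :
    Complex.exp (-(I * a)) = (Real.cos a : ℂ) - (Real.sin a : ℂ) * I := by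
  rw [show -(I * (a : ℂ)) = (-a : ℝ) * I by push_cast; ring, Complex.exp_mul_I, ← Complex.ofReal_cos,
    ← Complex.ofReal_sin, Real.cos_neg, Real.sin_neg]
  push_cast
  ring

/-- `e^{ia} = cos a + i sin a` (real `a`). [cite: Tasaki2020, §2.1 eq. (2.1.13)] -/
theorem exp_I_mul_ofReal (a : ℝ) :
    Complex.exp (I * a) = (Real.cos a : ℂ) + (Real.sin a : ℂ) * I := by
  rw [mul_comm, Complex.exp_mul_I, ← Complex.ofReal_cos, ← Complex.ofReal_sin]

/-- The single-site axial phase `D_a = diag_k(e^{-ia(n-k)}) = e^{-ia(Ŝᶻ + S)}` is unitary: `D_a D_aᴴ = 𝟙`.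
[cite: Tasaki2022, §3.1] -/
theorem axialPhase_mul_conjTranspose (a : ℝ) :
    diagonal (fun k : Fin (n + 1) => Complex.exp (-(I * ((a * ((k.rev : ℕ) : ℝ) : ℝ) : ℂ)))) *
      (diagonal fun k : Fin (n + 1) => Complex.exp (-(I * ((a * ((k.rev : ℕ) : ℝ) : ℝ) : ℂ))))ᴴ = 1 := by
  rw [diagonal_conjTranspose, diagonal_mul_diagonal, ← diagonal_one]
  congr 1
  funext k
  rw [Pi.star_apply, Complex.star_def, Complex.mul_conj, Complex.normSq_eq_norm_sq, Complex.norm_exp]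
  simp

/-- **Single site: the axial rotation by `a` rotates `Sˣ` in the plane**, `D_a Sˣ D_aᴴ = cos a Sˣ + sin a Sʸ`
(`Sˣ = ½(S⁺ + S⁻)`, `D_a S^± D_aᴴ = e^{∓ia} S^±`). [cite: Tasaki2020, §2.1 eqs. (2.1.6), (2.1.13)] -/
theorem axialPhase_conj_spinX (a : ℝ) :
    diagonal (fun k : Fin (n + 1) => Complex.exp (-(I * ((a * ((k.rev : ℕ) : ℝ) : ℝ) : ℂ)))) * spinX n *
        (diagonal fun k : Fin (n + 1) => Complex.exp (-(I * ((a * ((k.rev : ℕ) : ℝ) : ℝ) : ℂ))))ᴴ =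
      (Real.cos a : ℂ) • spinX n + (Real.sin a : ℂ) • spinY n := by
  rw [spinX, spinY, Matrix.mul_smul, Matrix.smul_mul, Matrix.mul_add, Matrix.add_mul, axialPhase_conj_spinRaise,
    axialPhase_conj_spinLower, exp_neg_I_mul_ofReal, exp_I_mul_ofReal]
  have hI : (1 / (2 * I) : ℂ) = -(1 / 2 : ℂ) * I := by
    field_simp
    rw [Complex.I_sq]
    ring
  rw [hI]
  push_cast
  match_scalars <;> ring

/-- **… and `Sʸ`**: `D_a Sʸ D_aᴴ = cos a Sʸ − sin a Sˣ`. [cite: Tasaki2020, §2.1 eqs. (2.1.6), (2.1.13)] -/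
theorem axialPhase_conj_spinY (a : ℝ) :
    diagonal (fun k : Fin (n + 1) => Complex.exp (-(I * ((a * ((k.rev : ℕ) : ℝ) : ℝ) : ℂ)))) * spinY n *
        (diagonal fun k : Fin (n + 1) => Complex.exp (-(I * ((a * ((k.rev : ℕ) : ℝ) : ℝ) : ℂ))))ᴴ =
      (Real.cos a : ℂ) • spinY n - (Real.sin a : ℂ) • spinX n := by
  rw [spinX, spinY, Matrix.mul_smul, Matrix.smul_mul, Matrix.mul_sub, Matrix.sub_mul, axialPhase_conj_spinRaise,
    axialPhase_conj_spinLower, exp_neg_I_mul_ofReal, exp_I_mul_ofReal]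
  have hI : (1 / (2 * I) : ℂ) = -(1 / 2 : ℂ) * I := by
    field_simp
    rw [Complex.I_sq]
    ring
  rw [hI]
  push_cast
  match_scalars <;> linear_combination ((1 / 2 : ℂ) * Complex.sin (a : ℂ)) * Complex.I_sq

variable {X : Type*} [Fintype X] [DecidableEq X]

/-- **The uniform axial rotation `U_a = exp[-ia Σ_x(Ŝᶻ_x + S)]` (`twistOp` with the constant angle `a`) rotates
every spin in the plane**: `U_a Sˣ_x U_aᴴ = cos a Sˣ_x + sin a Sʸ_x`. [cite: Tasaki2020, §2.2 eq. (2.2.13)]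
[cite: KomaTasaki1994, after Thm. 2.5 (the `U(1)` rotation `exp[iθC]`)] -/
theorem uniformTwist_conj_siteSpin_zero (a : ℝ) (x : X) :
    twistOp (fun _ : X => a) * siteSpin n x 0 * (twistOp (fun _ : X => a))ᴴ =
      (Real.cos a : ℂ) • siteSpin n x 0 + (Real.sin a : ℂ) • siteSpin n x 1 := by
  rw [twistOp_eq_productOp, productOp_conj_siteSpin (fun _ => axialPhase_mul_conjTranspose n a), spinVec_zero,
    axialPhase_conj_spinX, onSite_add', onSite_smul', onSite_smul']
  rfl

/-- `U_a Sʸ_x U_aᴴ = cos a Sʸ_x − sin a Sˣ_x`. [cite: Tasaki2020, §2.2 eq. (2.2.13)] -/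
theorem uniformTwist_conj_siteSpin_one (a : ℝ) (x : X) :
    twistOp (fun _ : X => a) * siteSpin n x 1 * (twistOp (fun _ : X => a))ᴴ =
      (Real.cos a : ℂ) • siteSpin n x 1 - (Real.sin a : ℂ) • siteSpin n x 0 := by
  rw [twistOp_eq_productOp, productOp_conj_siteSpin (fun _ => axialPhase_mul_conjTranspose n a), spinVec_one,
    axialPhase_conj_spinY, onSite_sub', onSite_smul', onSite_smul']
  rfl

/-- `U_a Sᶻ_x U_aᴴ = Sᶻ_x` (the rotation is about the `3`-axis). [cite: Tasaki2020, §2.2 eq. (2.2.13)] -/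
theorem uniformTwist_conj_siteSpin_two (a : ℝ) (x : X) :
    twistOp (fun _ : X => a) * siteSpin n x 2 * (twistOp (fun _ : X => a))ᴴ = siteSpin n x 2 := by
  rw [twistOp_eq_productOp, productOp_conj_siteSpin (fun _ => axialPhase_mul_conjTranspose n a), spinVec_two,
    axialPhase_conj_spinZ]
  rfl

/-- `U_a S⁻_x U_aᴴ = e^{ia} S⁻_x` — the lowering operator (the hard-core boson ANNIHILATION operator `a_x`) carries
charge `-1`. [cite: Tasaki2022, §3.1 Lemma 3.1] [cite: KomaTasaki1994, §3.3] -/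
theorem uniformTwist_conj_onSite_spinLower (a : ℝ) (x : X) :
    twistOp (fun _ : X => a) * onSite x (spinLower n) * (twistOp (fun _ : X => a))ᴴ =
      Complex.exp (I * a) • (onSite x (spinLower n) : Op X (n + 1)) := by
  rw [twistOp_eq_productOp, productOp_conj_onSite (fun _ => axialPhase_mul_conjTranspose n a),
    axialPhase_conj_spinLower, onSite_smul']

/-- `U_a S⁺_x U_aᴴ = e^{-ia} S⁺_x` (the boson CREATION operator `a†_x`, charge `+1`).
[cite: Tasaki2022, §3.1 Lemma 3.1] [cite: KomaTasaki1994, §3.3] -/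
theorem uniformTwist_conj_onSite_spinRaise (a : ℝ) (x : X) :
    twistOp (fun _ : X => a) * onSite x (spinRaise n) * (twistOp (fun _ : X => a))ᴴ =
      Complex.exp (-(I * a)) • (onSite x (spinRaise n) : Op X (n + 1)) := by
  rw [twistOp_eq_productOp, productOp_conj_onSite (fun _ => axialPhase_mul_conjTranspose n a),
    axialPhase_conj_spinRaise, onSite_smul']

/-- `U_{a+b} = U_a U_b` (the uniform rotations form a one-parameter group). [cite: Tasaki2022, §3.1] -/
theorem uniformTwist_add {q : ℕ} (a b : ℝ) :
    (twistOp (fun _ : X => a + b) : Op X q) = twistOp (fun _ : X => a) * twistOp (fun _ : X => b) := by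
  rw [← twistOp_add]
  rfl

omit [DecidableEq X] in
/-- `U_{2πk} = 𝟙` (`k ∈ ℤ`): the charges `Σ_x(Ŝᶻ_x + S)` are integers. [cite: Tasaki2022, §3.1] -/
theorem uniformTwist_int_mul_two_pi {q : ℕ} (k : ℤ) :
    (twistOp (fun _ : X => (k : ℝ) * (2 * Real.pi)) : Op X q) = 1 := by
  rw [twistOp, ← diagonal_one]
  congr 1
  funext σ
  rw [Complex.exp_eq_one_iff]
  refine ⟨-(k * ((∑ x : X, ((σ x).rev : ℕ) : ℕ) : ℤ)), ?_⟩
  simp only [twistPhase, ← Finset.mul_sum]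
  push_cast
  ring

/-- `U_{a + 2πk} = U_a`. [cite: Tasaki2022, §3.1] -/
theorem uniformTwist_add_int_mul_two_pi {q : ℕ} (a : ℝ) (k : ℤ) :
    (twistOp (fun _ : X => a + (k : ℝ) * (2 * Real.pi)) : Op X q) = twistOp (fun _ : X => a) := by
  rw [uniformTwist_add, uniformTwist_int_mul_two_pi, Matrix.mul_one]

/-- **The planar exchange is `U(1)`-invariant**: `U_a (Bˣ_{xy} + Bʸ_{xy}) U_aᴴ = Bˣ_{xy} + Bʸ_{xy}`
(`cos² a + sin² a = 1`). [cite: KomaTasaki1994, §3.3] [cite: Tasaki2020, §2.4] -/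
theorem uniformTwist_conj_spinBond_zero_add_one (a : ℝ) (x y : X) :
    twistOp (fun _ : X => a) * (spinBond n 0 x y + spinBond n 1 x y) * (twistOp (fun _ : X => a))ᴴ =
      spinBond n 0 x y + spinBond n 1 x y := by
  have hcs : Complex.cos (a : ℂ) ^ 2 + Complex.sin (a : ℂ) ^ 2 = 1 := Complex.cos_sq_add_sin_sq _
  simp only [spinBond, Matrix.mul_add, Matrix.add_mul, Matrix.mul_smul, Matrix.smul_mul]
  rw [twistOp_conj_mul, twistOp_conj_mul _ (siteSpin n y 0), twistOp_conj_mul _ (siteSpin n x 1),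
    twistOp_conj_mul _ (siteSpin n y 1)]
  simp only [uniformTwist_conj_siteSpin_zero, uniformTwist_conj_siteSpin_one]
  simp only [Matrix.mul_add, Matrix.add_mul, Matrix.mul_sub, Matrix.sub_mul, Matrix.smul_mul, Matrix.mul_smul,
    smul_add, smul_sub, smul_smul]
  push_cast
  match_scalars <;> first | ring1 | linear_combination (1 / 2 : ℂ) * hcs

/-- The axial bond is `U(1)`-invariant: `U_a Bᶻ_{xy} U_aᴴ = Bᶻ_{xy}`. [cite: Tasaki2020, §2.4] -/
theorem uniformTwist_conj_spinBond_two (a : ℝ) (x y : X) :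
    twistOp (fun _ : X => a) * spinBond n 2 x y * (twistOp (fun _ : X => a))ᴴ = spinBond n 2 x y := by
  rw [spinBond, Matrix.mul_smul, Matrix.smul_mul, Matrix.mul_add, Matrix.add_mul, twistOp_conj_mul,
    twistOp_conj_mul _ (siteSpin n y 2), uniformTwist_conj_siteSpin_two, uniformTwist_conj_siteSpin_two]

/-- **The XXZ bond `Bˣ + Bʸ + ΔBᶻ` is `U(1)`-invariant.** [cite: KomaTasaki1994, §3.3] [cite: Tasaki2020, §2.4] -/
theorem uniformTwist_conj_xxzBond (a Δ : ℝ) (x y : X) :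
    twistOp (fun _ : X => a) * XXZKT.bond n Δ x y * (twistOp (fun _ : X => a))ᴴ = XXZKT.bond n Δ x y := by
  rw [XXZKT.bond, Matrix.mul_add, Matrix.add_mul, uniformTwist_conj_spinBond_zero_add_one, Matrix.mul_smul,
    Matrix.smul_mul, uniformTwist_conj_spinBond_two]

/-- **The XXZ Hamiltonian on any graph is `U(1)`-invariant**: `U_a H_{XXZ} U_aᴴ = H_{XXZ}` for every `J, Δ, a`.
[cite: KomaTasaki1993, §1] [cite: Tasaki2020, §2.4] -/
theorem uniformTwist_conj_xxzHamiltonian (G : SimpleGraph X) [DecidableRel G.Adj] (a J Δ : ℝ) :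
    twistOp (fun _ : X => a) * xxzHamiltonian n G J Δ * (twistOp (fun _ : X => a))ᴴ = xxzHamiltonian n G J Δ := by
  rw [XXZKT.xxzHamiltonian_eq_sum_bond, Matrix.mul_smul, Matrix.smul_mul, Finset.mul_sum, Finset.sum_mul]
  congr 1
  refine Finset.sum_congr rfl fun e _ => ?_
  induction e using Sym2.ind with
  | h x y =>
    simp only [Sym2.lift_mk]
    exact uniformTwist_conj_xxzBond n a Δ x y

end Rotation

/-! ## §2 `U(1)` invariance of the XXZ interaction on `ℤ^d`; twist covariance of ground and dKMS states -/

section Interaction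

variable {d : ℕ} (n : ℕ)

/-- **The XXZ interaction on `ℤ^d` is `U(1)`-invariant**: `U_Y Φ Y U_Yᴴ = Φ Y` for every region `Y` and angle `a`.
[cite: KomaTasaki1993, §1] [cite: BratteliRobinsonII1997, §6.2.1] -/
theorem uniformTwist_conj_xxzLatticeInteraction (a J Δ : ℝ) (Y : Finset (Site d)) :
    twistOp (fun _ : ↥Y => a) * xxzLatticeInteraction d n J Δ Y * (twistOp (fun _ : ↥Y => a))ᴴ =
      xxzLatticeInteraction d n J Δ Y := by
  rw [xxzLatticeInteraction_apply]
  split_ifs with hY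
  · rw [Matrix.mul_smul, Matrix.smul_mul, Finset.mul_sum, Finset.sum_mul]
    congr 1
    refine Finset.sum_congr rfl fun x _ => ?_
    rw [Finset.mul_sum, Finset.sum_mul]
    refine Finset.sum_congr rfl fun y _ => ?_
    split_ifs with hxy
    · exact uniformTwist_conj_xxzBond n a Δ x y
    · rw [Matrix.mul_zero, Matrix.zero_mul]
  · rw [Matrix.mul_zero, Matrix.zero_mul]

end Interaction

namespace InfVolState

variable {d q : ℕ}

/-- **Twists of dKMS states are dKMS states (of the twisted interaction).**  If `Φ' Y = U_Y Φ Y U_Yᴴ` for every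
region, `ω` is a dKMS state of `Φ'` at `β` and `ω'_Λ(A) = ω_Λ(U_Λ A U_Λᴴ)`, then `ω'` is a dKMS state of `Φ` at `β`: with
`B = U_Λ A U_Λᴴ` one has `ω'(AᴴA) = ω(BᴴB)`, `ω'(AAᴴ) = ω(BBᴴ)` and `ω'(Ãᴴ δ_Φ A) = ω(B̃ᴴ δ_{Φ'} B)`
(`twistOp_conj_derivation`), so the three Araki–Moriya clauses for `ω'` at `(Λ, A)` are those for `ω` at `(Λ, B)` —
the energy–entropy-balance form of «`ω ∘ α` is a KMS state when the automorphism `α` commutes with the dynamics».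
[cite: BratteliRobinsonII1997, §5.3.1 and Thm. 6.2.4] [cite: ArakiMoriya2003, Def 6.3] -/
theorem IsDKMSState.of_expect_eq_twist (Θ : Site d → ℝ) {Φ Φ' : LatticeInteraction d q}
    (hrel : ∀ Y, Φ' Y = twistOp (fun x : ↥Y => Θ x) * Φ Y * (twistOp (fun x : ↥Y => Θ x))ᴴ) {R β : ℝ}
    {ω ω' : InfVolState d q} (hω : ω.IsDKMSState Φ' R β)
    (htw : ∀ (Λ : Finset (Site d)) (A : Op ↥Λ q),
      ω'.expect Λ A = ω.expect Λ (twistOp (fun x : ↥Λ => Θ x) * A * (twistOp (fun x : ↥Λ => Θ x))ᴴ)) :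
    ω'.IsDKMSState Φ R β := by
  intro Λ A
  simp only [htw, twistOp_conj_mul, twistOp_conj_conjTranspose, twistOp_conj_embedOp]
  rw [twistOp_conj_derivation Θ hrel]
  exact hω Λ _

/-- **A unique dKMS state is invariant under the twist symmetries of the interaction**: if `U_Y Φ Y U_Yᴴ = Φ Y` for all
`Y` and `ω` is the ONLY dKMS state of `Φ` at `β`, then `ω_Λ(U_Λ A U_Λᴴ) = ω_Λ(A)` for every local `A`.
[cite: BratteliRobinsonII1997, §5.3.1] [cite: Tasaki2022, §3 (before Cor. 3.6)] -/
theorem IsDKMSState.expect_twist_of_unique (Θ : Site d → ℝ) {Φ : LatticeInteraction d q}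
    (hinv : ∀ Y : Finset (Site d), twistOp (fun x : ↥Y => Θ x) * Φ Y * (twistOp (fun x : ↥Y => Θ x))ᴴ = Φ Y)
    {R β : ℝ} {ω : InfVolState d q} (hω : ω.IsDKMSState Φ R β)
    (huniq : ∀ ω' : InfVolState d q, ω'.IsDKMSState Φ R β → ω' = ω) (Λ : Finset (Site d)) (A : Op ↥Λ q) :
    ω.expect Λ (twistOp (fun x : ↥Λ => Θ x) * A * (twistOp (fun x : ↥Λ => Θ x))ᴴ) = ω.expect Λ A := by
  obtain ⟨ω', hω'⟩ := ω.exists_twist Θ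
  have h' : ω' = ω := huniq ω' (IsDKMSState.of_expect_eq_twist Θ (fun Y => (hinv Y).symm) hω hω')
  rw [← hω', h']

end InfVolState

namespace XXZKT

section Covariance

variable {d n : ℕ} {J Δ : ℝ}

/-- **Uniform rotations map infinite-volume ground states of the XXZ model to ground states** (every `d`, `S`, `J`, `Δ`,
range parameter `R`, angle `a`): if `ω'_Λ(A) = ω_Λ(U_a A U_aᴴ)` and `ω` is a ground state, so is `ω'`.
[cite: KomaTasaki1994, Cor. 2.9] [cite: BratteliRobinsonII1997, Prop. 5.3.19, §6.2.7] -/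
theorem isGroundState_of_uniformTwist {R : ℝ} (a : ℝ) {ω ω' : InfVolState d (n + 1)}
    (hω : ω.IsGroundState (xxzLatticeInteraction d n J Δ) R)
    (htw : ∀ (Λ : Finset (Site d)) (A : Op ↥Λ (n + 1)),
      ω'.expect Λ A = ω.expect Λ (twistOp (fun _ : ↥Λ => a) * A * (twistOp (fun _ : ↥Λ => a))ᴴ)) :
    ω'.IsGroundState (xxzLatticeInteraction d n J Δ) R :=
  InfVolState.IsGroundState.of_expect_eq_twist (fun _ : Site d => a)
    (fun Y => (uniformTwist_conj_xxzLatticeInteraction n a J Δ Y).symm) hω htw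

/-- **Uniform rotations map dKMS states of the XXZ model at `β` to dKMS states at `β`.**
[cite: KomaTasaki1994, Cor. 2.9] [cite: BratteliRobinsonII1997, §5.3.1] [cite: ArakiMoriya2003, Def 6.3] -/
theorem isDKMSState_of_uniformTwist {R β : ℝ} (a : ℝ) {ω ω' : InfVolState d (n + 1)}
    (hω : ω.IsDKMSState (xxzLatticeInteraction d n J Δ) R β)
    (htw : ∀ (Λ : Finset (Site d)) (A : Op ↥Λ (n + 1)),
      ω'.expect Λ A = ω.expect Λ (twistOp (fun _ : ↥Λ => a) * A * (twistOp (fun _ : ↥Λ => a))ᴴ)) :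
    ω'.IsDKMSState (xxzLatticeInteraction d n J Δ) R β :=
  InfVolState.IsDKMSState.of_expect_eq_twist (fun _ : Site d => a)
    (fun Y => (uniformTwist_conj_xxzLatticeInteraction n a J Δ Y).symm) hω htw

/-! ### The converse of symmetry breaking: uniqueness ⇒ `U(1)` invariance ⇒ charged observables vanish -/

/-- **If the XXZ model on `ℤ^d` has a UNIQUE infinite-volume ground state, every charged local observable has zero
ground-state expectation**: `U_a A U_aᴴ = c·A` with `c ≠ 1` for some angle `a` forces `ω(A) = 0` (uniqueness ⇒ `U(1)`
invariance, `ω(A) = ω(U_aAU_aᴴ) = c·ω(A)`).  Examples: `S⁻_x = a_x` (`c = e^{ia}`), `S⁻_xS⁻_y`, `Sˣ_x` (`a = π`, `c = -1`).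
[cite: Tasaki2022, §3 (before Cor. 3.6)] [cite: KomaTasaki1994, §2.4] -/
theorem expect_eq_zero_of_hasUniqueGroundState {R : ℝ} (hU : HasUniqueGroundState (xxzLatticeInteraction d n J Δ) R)
    {ω : InfVolState d (n + 1)} (hω : ω ∈ groundStates (xxzLatticeInteraction d n J Δ) R) {Λ : Finset (Site d)}
    {A : Op ↥Λ (n + 1)} (a : ℝ) {c : ℂ} (hA : twistOp (fun _ : ↥Λ => a) * A * (twistOp (fun _ : ↥Λ => a))ᴴ = c • A)
    (hc : c ≠ 1) : ω.expect Λ A = 0 := by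
  have h := HasUniqueGroundState.expect_twist (fun _ : Site d => a) (uniformTwist_conj_xxzLatticeInteraction n a J Δ)
    hU hω Λ A
  rw [hA, map_smul, smul_eq_mul] at h
  have h' : (c - 1) * ω.expect Λ A = 0 := by rw [sub_mul, one_mul, h, sub_self]
  exact (mul_eq_zero.1 h').resolve_left (sub_ne_zero.2 hc)

/-- **… and likewise if the dKMS state at `β` is unique** (no spontaneous `U(1)` breaking in a unique equilibrium state).
[cite: BratteliRobinsonII1997, §5.3.1] [cite: Tasaki2022, §3 (before Cor. 3.6)] -/
theorem expect_eq_zero_of_dKMSState_unique {R β : ℝ} {ω : InfVolState d (n + 1)}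
    (hω : ω.IsDKMSState (xxzLatticeInteraction d n J Δ) R β)
    (huniq : ∀ ω' : InfVolState d (n + 1), ω'.IsDKMSState (xxzLatticeInteraction d n J Δ) R β → ω' = ω)
    {Λ : Finset (Site d)} {A : Op ↥Λ (n + 1)} (a : ℝ) {c : ℂ}
    (hA : twistOp (fun _ : ↥Λ => a) * A * (twistOp (fun _ : ↥Λ => a))ᴴ = c • A) (hc : c ≠ 1) :
    ω.expect Λ A = 0 := by
  have h := InfVolState.IsDKMSState.expect_twist_of_unique (fun _ : Site d => a)
    (uniformTwist_conj_xxzLatticeInteraction n a J Δ) hω huniq Λ A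
  rw [hA, map_smul, smul_eq_mul] at h
  have h' : (c - 1) * ω.expect Λ A = 0 := by rw [sub_mul, one_mul, h, sub_self]
  exact (mul_eq_zero.1 h').resolve_left (sub_ne_zero.2 hc)

/-- `U_π Sˣ_x U_πᴴ = -Sˣ_x`. [cite: Tasaki2020, §2.2 eq. (2.2.13)] -/
theorem uniformTwist_pi_conj_siteSpin_zero {X : Type*} [Fintype X] [DecidableEq X] (x : X) :
    twistOp (fun _ : X => Real.pi) * siteSpin n x 0 * (twistOp (fun _ : X => Real.pi))ᴴ = -siteSpin n x 0 := by
  rw [uniformTwist_conj_siteSpin_zero, Real.cos_pi, Real.sin_pi]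
  simp

/-- `U_π Sʸ_x U_πᴴ = -Sʸ_x`. [cite: Tasaki2020, §2.2 eq. (2.2.13)] -/
theorem uniformTwist_pi_conj_siteSpin_one {X : Type*} [Fintype X] [DecidableEq X] (x : X) :
    twistOp (fun _ : X => Real.pi) * siteSpin n x 1 * (twistOp (fun _ : X => Real.pi))ᴴ = -siteSpin n x 1 := by
  rw [uniformTwist_conj_siteSpin_one, Real.cos_pi, Real.sin_pi]
  simp

/-- **A unique infinite-volume ground state of the XXZ model has no planar magnetisation**: `ω(Sˣ_x) = ω(Sʸ_x) = 0` at
every site (every `d`, `S`, `J`, `Δ`).  Contrapositive: planar long-range order (§4) forces non-uniqueness.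
[cite: Tasaki2022, §3 (before Cor. 3.6)] [cite: KomaTasaki1994, §2.4] -/
theorem expect_siteSpinAt_planar_eq_zero_of_hasUniqueGroundState {R : ℝ}
    (hU : HasUniqueGroundState (xxzLatticeInteraction d n J Δ) R) {ω : InfVolState d (n + 1)}
    (hω : ω ∈ groundStates (xxzLatticeInteraction d n J Δ) R) (x : Site d) :
    ω.expect {x} (siteSpinAt n x 0) = 0 ∧ ω.expect {x} (siteSpinAt n x 1) = 0 :=
  ⟨expect_eq_zero_of_hasUniqueGroundState hU hω Real.pi (c := -1)
      (by rw [siteSpinAt, uniformTwist_pi_conj_siteSpin_zero, neg_one_smul]) (by norm_num),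
    expect_eq_zero_of_hasUniqueGroundState hU hω Real.pi (c := -1)
      (by rw [siteSpinAt, uniformTwist_pi_conj_siteSpin_one, neg_one_smul]) (by norm_num)⟩

/-- **A unique dKMS state of the XXZ model has no planar magnetisation.** [cite: BratteliRobinsonII1997, §5.3.1] -/
theorem expect_siteSpinAt_planar_eq_zero_of_dKMSState_unique {R β : ℝ} {ω : InfVolState d (n + 1)}
    (hω : ω.IsDKMSState (xxzLatticeInteraction d n J Δ) R β)
    (huniq : ∀ ω' : InfVolState d (n + 1), ω'.IsDKMSState (xxzLatticeInteraction d n J Δ) R β → ω' = ω) (x : Site d) :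
    ω.expect {x} (siteSpinAt n x 0) = 0 ∧ ω.expect {x} (siteSpinAt n x 1) = 0 :=
  ⟨expect_eq_zero_of_dKMSState_unique hω huniq Real.pi (c := -1)
      (by rw [siteSpinAt, uniformTwist_pi_conj_siteSpin_zero, neg_one_smul]) (by norm_num),
    expect_eq_zero_of_dKMSState_unique hω huniq Real.pi (c := -1)
      (by rw [siteSpinAt, uniformTwist_pi_conj_siteSpin_one, neg_one_smul]) (by norm_num)⟩

/-- **A unique ground state has no condensate**: `ω(S⁻_x) = ω(a_x) = 0` (`U_aS⁻U_aᴴ = e^{ia}S⁻`, `e^{iπ} = -1 ≠ 1`).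
[cite: KomaTasaki1994, §3.3] [cite: Tasaki2022, §3 (before Cor. 3.6)] -/
theorem expect_spinLower_eq_zero_of_hasUniqueGroundState {R : ℝ}
    (hU : HasUniqueGroundState (xxzLatticeInteraction d n J Δ) R) {ω : InfVolState d (n + 1)}
    (hω : ω ∈ groundStates (xxzLatticeInteraction d n J Δ) R) (x : Site d) :
    ω.expect {x} (onSite (⟨x, mem_singleton_self x⟩ : ↥({x} : Finset (Site d))) (spinLower n)) = 0 :=
  expect_eq_zero_of_hasUniqueGroundState hU hω Real.pi (c := Complex.exp (I * Real.pi))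
    (uniformTwist_conj_onSite_spinLower n Real.pi _) (by rw [mul_comm, Complex.exp_pi_mul_I]; norm_num)

end Covariance

/-! ## §3 The `x`-sourced states have no `y`- and no `z`-moment (the symmetry `W = (half turn about y)·U_π`) -/

section Torus

variable {d L : ℕ} [NeZero L] (n : ℕ)

/-- `W Sˣ_z Wᴴ = Sˣ_z` for `W = (half turn about y)·U_π` (`U_π` reverses `Sˣ, Sʸ`, the half turn about `y` reverses
`Sˣ, Sᶻ`; `W` is the half turn about the `x`-axis up to a phase). [cite: KomaTasaki1993, §2 (2.3)–(2.5)] -/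
theorem halfTurnYPi_conj_siteSpin_zero (z : TorusSite d L) :
    halfTurnY n * twistOp (fun _ : TorusSite d L => Real.pi) * siteSpin n z 0 *
        (halfTurnY n * twistOp (fun _ : TorusSite d L => Real.pi))ᴴ = siteSpin n z 0 := by
  rw [conjTranspose_mul, show halfTurnY n * twistOp (fun _ : TorusSite d L => Real.pi) * siteSpin n z 0 *
      ((twistOp (fun _ : TorusSite d L => Real.pi))ᴴ * (halfTurnY n)ᴴ) =
      halfTurnY n * (twistOp (fun _ : TorusSite d L => Real.pi) * siteSpin n z 0 *
        (twistOp (fun _ : TorusSite d L => Real.pi))ᴴ) * (halfTurnY n)ᴴ by noncomm_ring,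
    uniformTwist_pi_conj_siteSpin_zero, Matrix.mul_neg, Matrix.neg_mul, halfTurnY_conj_siteSpin_zero, neg_neg]

/-- `W Sʸ_z Wᴴ = -Sʸ_z`. [cite: KomaTasaki1993, §2 (2.3)–(2.5)] -/
theorem halfTurnYPi_conj_siteSpin_one (z : TorusSite d L) :
    halfTurnY n * twistOp (fun _ : TorusSite d L => Real.pi) * siteSpin n z 1 *
        (halfTurnY n * twistOp (fun _ : TorusSite d L => Real.pi))ᴴ = -siteSpin n z 1 := by
  rw [conjTranspose_mul, show halfTurnY n * twistOp (fun _ : TorusSite d L => Real.pi) * siteSpin n z 1 *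
      ((twistOp (fun _ : TorusSite d L => Real.pi))ᴴ * (halfTurnY n)ᴴ) =
      halfTurnY n * (twistOp (fun _ : TorusSite d L => Real.pi) * siteSpin n z 1 *
        (twistOp (fun _ : TorusSite d L => Real.pi))ᴴ) * (halfTurnY n)ᴴ by noncomm_ring,
    uniformTwist_pi_conj_siteSpin_one, Matrix.mul_neg, Matrix.neg_mul, halfTurnY_conj_siteSpin_one]

/-- `W Sᶻ_z Wᴴ = -Sᶻ_z`. [cite: KomaTasaki1993, §2 (2.3)–(2.5)] -/
theorem halfTurnYPi_conj_siteSpin_two (z : TorusSite d L) :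
    halfTurnY n * twistOp (fun _ : TorusSite d L => Real.pi) * siteSpin n z 2 *
        (halfTurnY n * twistOp (fun _ : TorusSite d L => Real.pi))ᴴ = -siteSpin n z 2 := by
  rw [conjTranspose_mul, show halfTurnY n * twistOp (fun _ : TorusSite d L => Real.pi) * siteSpin n z 2 *
      ((twistOp (fun _ : TorusSite d L => Real.pi))ᴴ * (halfTurnY n)ᴴ) =
      halfTurnY n * (twistOp (fun _ : TorusSite d L => Real.pi) * siteSpin n z 2 *
        (twistOp (fun _ : TorusSite d L => Real.pi))ᴴ) * (halfTurnY n)ᴴ by noncomm_ring,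
    uniformTwist_conj_siteSpin_two, halfTurnY_conj_siteSpin_two]

/-- `W` fixes the staggered `x`-spin `O^x = Σ_z (-1)^z Sˣ_z`. [cite: KomaTasaki1993, §2 (2.3)] -/
theorem halfTurnYPi_conj_stagSpin_zero (σ : TorusSite d L → ℕ) :
    halfTurnY n * twistOp (fun _ : TorusSite d L => Real.pi) * stagSpin n σ 0 *
        (halfTurnY n * twistOp (fun _ : TorusSite d L => Real.pi))ᴴ = (stagSpin n σ 0 : Op (TorusSite d L) (n + 1)) := by
  rw [stagSpin, Finset.mul_sum, Finset.sum_mul]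
  refine Finset.sum_congr rfl fun x _ => ?_
  rw [Matrix.mul_smul, Matrix.smul_mul, halfTurnYPi_conj_siteSpin_zero]

/-- `W` is a symmetry of the Hamiltonian sourced along `x`: `W (H − BO^x) Wᴴ = H − BO^x`. [cite: KomaTasaki1993, §2 (2.3)] -/
theorem halfTurnYPi_conj_sourcedAF_zero (J Δ B : ℝ) :
    halfTurnY n * twistOp (fun _ : TorusSite d L => Real.pi) * sourcedAF d L n J Δ 0 B *
        (halfTurnY n * twistOp (fun _ : TorusSite d L => Real.pi))ᴴ = sourcedAF d L n J Δ 0 B := by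
  have hH : halfTurnY n * twistOp (fun _ : TorusSite d L => Real.pi) * xxzHamiltonian n (torusGraph d L) J Δ *
      (halfTurnY n * twistOp (fun _ : TorusSite d L => Real.pi))ᴴ = xxzHamiltonian n (torusGraph d L) J Δ := by
    rw [conjTranspose_mul, show halfTurnY n * twistOp (fun _ : TorusSite d L => Real.pi) *
        xxzHamiltonian n (torusGraph d L) J Δ * ((twistOp (fun _ : TorusSite d L => Real.pi))ᴴ * (halfTurnY n)ᴴ) =
        halfTurnY n * (twistOp (fun _ : TorusSite d L => Real.pi) * xxzHamiltonian n (torusGraph d L) J Δ *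
          (twistOp (fun _ : TorusSite d L => Real.pi))ᴴ) * (halfTurnY n)ᴴ by noncomm_ring,
      uniformTwist_conj_xxzHamiltonian, halfTurnY_conj_xxzHamiltonian]
  rw [sourcedAF, Matrix.mul_sub, Matrix.sub_mul, Matrix.mul_smul, Matrix.smul_mul, hH, halfTurnYPi_conj_stagSpin_zero]

/-- `Wᴴ W = 1`. [cite: KomaTasaki1993, §2] -/
theorem halfTurnYPi_conjTranspose_mul :
    (halfTurnY n * twistOp (fun _ : TorusSite d L => Real.pi))ᴴ *
      (halfTurnY n * twistOp (fun _ : TorusSite d L => Real.pi)) = (1 : Op (TorusSite d L) (n + 1)) := by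
  rw [conjTranspose_mul, Matrix.mul_assoc, ← Matrix.mul_assoc (halfTurnY n)ᴴ, halfTurnY_conjTranspose_mul,
    Matrix.one_mul, twistOp_conjTranspose_mul_self]

/-- `W Wᴴ = 1`. [cite: KomaTasaki1993, §2] -/
theorem halfTurnYPi_mul_conjTranspose :
    halfTurnY n * twistOp (fun _ : TorusSite d L => Real.pi) *
      (halfTurnY n * twistOp (fun _ : TorusSite d L => Real.pi))ᴴ = (1 : Op (TorusSite d L) (n + 1)) := by
  rw [conjTranspose_mul, Matrix.mul_assoc, ← Matrix.mul_assoc (twistOp _), twistOp_mul_conjTranspose_self,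
    Matrix.one_mul, halfTurnY_mul_conjTranspose]

/-- **No `y`-magnetisation in the `x`-sourced Gibbs state**: `⟨Sʸ_z⟩_{β, H − BO^x} = 0`. [cite: KomaTasaki1993, §2 (2.3)–(2.5)] -/
theorem gibbsState_sourcedAF_zero_siteSpin_one (J Δ β B : ℝ) (z : TorusSite d L) :
    gibbsState β (sourcedAF d L n J Δ 0 B) (siteSpin n z 1) = 0 := by
  have h := gibbsState_conj_of_symmetry β (halfTurnYPi_conjTranspose_mul n) (halfTurnYPi_mul_conjTranspose n)
    (halfTurnYPi_conj_sourcedAF_zero (L := L) n J Δ B) (siteSpin n z 1)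
  rw [halfTurnYPi_conj_siteSpin_one, map_neg] at h
  linear_combination (-(1 : ℂ) / 2) * h

/-- **No `z`-magnetisation in the `x`-sourced Gibbs state**: `⟨Sᶻ_z⟩_{β, H − BO^x} = 0`. [cite: KomaTasaki1993, §2 (2.3)–(2.5)] -/
theorem gibbsState_sourcedAF_zero_siteSpin_two (J Δ β B : ℝ) (z : TorusSite d L) :
    gibbsState β (sourcedAF d L n J Δ 0 B) (siteSpin n z 2) = 0 := by
  have h := gibbsState_conj_of_symmetry β (halfTurnYPi_conjTranspose_mul n) (halfTurnYPi_mul_conjTranspose n)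
    (halfTurnYPi_conj_sourcedAF_zero (L := L) n J Δ B) (siteSpin n z 2)
  rw [halfTurnYPi_conj_siteSpin_two, map_neg] at h
  linear_combination (-(1 : ℂ) / 2) * h

/-- **No `y`-magnetisation in the `x`-sourced tracial ground state** of `H − BO^x`. [cite: KomaTasaki1993, §2 (2.3)–(2.5), §7] -/
theorem groundStateFunctional_sourcedAF_zero_siteSpin_one (J Δ B : ℝ) (z : TorusSite d L) :
    (sourcedAF d L n J Δ 0 B).groundStateFunctional (siteSpin n z 1) = 0 := by
  have h := groundStateFunctional_conj_of_symmetry (sourcedAF_isHermitian n J Δ 0 B)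
    (halfTurnYPi_conjTranspose_mul n) (halfTurnYPi_conj_sourcedAF_zero (L := L) n J Δ B) (siteSpin n z 1)
  rw [halfTurnYPi_conj_siteSpin_one, map_neg] at h
  linear_combination (-(1 : ℂ) / 2) * h

/-- **No `z`-magnetisation in the `x`-sourced tracial ground state** of `H − BO^x`. [cite: KomaTasaki1993, §2 (2.3)–(2.5), §7] -/
theorem groundStateFunctional_sourcedAF_zero_siteSpin_two (J Δ B : ℝ) (z : TorusSite d L) :
    (sourcedAF d L n J Δ 0 B).groundStateFunctional (siteSpin n z 2) = 0 := by
  have h := groundStateFunctional_conj_of_symmetry (sourcedAF_isHermitian n J Δ 0 B)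
    (halfTurnYPi_conjTranspose_mul n) (halfTurnYPi_conj_sourcedAF_zero (L := L) n J Δ B) (siteSpin n z 2)
  rw [halfTurnYPi_conj_siteSpin_two, map_neg] at h
  linear_combination (-(1 : ℂ) / 2) * h

end Torus

section OnePoint

variable {d n : ℕ} {J Δ β : ℝ} {ω : InfVolState d (n + 1)}

/-- The `x`-sourced infinitesimal-field thermal state has `ω̃(Sʸ_x) = 0`. [cite: KomaTasaki1993, §2 (2.3)–(2.5), §1 (1.8)] -/
theorem IsInfinitesimalFieldThermalState.expect_siteSpinAt_one_eq_zero_of_zero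
    (h : IsInfinitesimalFieldThermalState d n J Δ 0 β ω) (x : Site d) : ω.expect {x} (siteSpinAt n x 1) = 0 :=
  IsInfinitesimalFieldState.expect_siteSpinAt_eq_zero h
    (fun B _ y => gibbsState_sourcedAF_zero_siteSpin_one n J Δ β B y) x

/-- The `x`-sourced infinitesimal-field thermal state has `ω̃(Sᶻ_x) = 0`. [cite: KomaTasaki1993, §2 (2.3)–(2.5), §1 (1.8)] -/
theorem IsInfinitesimalFieldThermalState.expect_siteSpinAt_two_eq_zero_of_zero
    (h : IsInfinitesimalFieldThermalState d n J Δ 0 β ω) (x : Site d) : ω.expect {x} (siteSpinAt n x 2) = 0 :=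
  IsInfinitesimalFieldState.expect_siteSpinAt_eq_zero h
    (fun B _ y => gibbsState_sourcedAF_zero_siteSpin_two n J Δ β B y) x

/-- The `x`-sourced infinitesimal-field ground state has `ω̃(Sʸ_x) = 0`. [cite: KomaTasaki1993, §2 (2.3)–(2.5), §7] -/
theorem IsInfinitesimalFieldGroundState.expect_siteSpinAt_one_eq_zero_of_zero
    (h : IsInfinitesimalFieldGroundState d n J Δ 0 ω) (x : Site d) : ω.expect {x} (siteSpinAt n x 1) = 0 :=
  IsInfinitesimalFieldState.expect_siteSpinAt_eq_zero h
    (fun B _ y => groundStateFunctional_sourcedAF_zero_siteSpin_one n J Δ B y) x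

/-- The `x`-sourced infinitesimal-field ground state has `ω̃(Sᶻ_x) = 0`. [cite: KomaTasaki1993, §2 (2.3)–(2.5), §7] -/
theorem IsInfinitesimalFieldGroundState.expect_siteSpinAt_two_eq_zero_of_zero
    (h : IsInfinitesimalFieldGroundState d n J Δ 0 ω) (x : Site d) : ω.expect {x} (siteSpinAt n x 2) = 0 :=
  IsInfinitesimalFieldState.expect_siteSpinAt_eq_zero h
    (fun B _ y => groundStateFunctional_sourcedAF_zero_siteSpin_two n J Δ B y) x

/-- **The `x`-sourced states as a real vector**: `ω(Sˣ_x) = (-1)^x m` with the SAME real `m = Re ω(Sˣ_0)` at every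
site, for every `x`-sourced infinitesimal-field ground state (site-independence (1.9) and reality of a state on a
Hermitian element). [cite: KomaTasaki1993, §1 (1.9)] [cite: BratteliRobinsonI1987, Prop. 2.3.11(a)] -/
theorem IsInfinitesimalFieldGroundState.expect_siteSpinAt_zero_eq_of_zero
    (h : IsInfinitesimalFieldGroundState d n J Δ 0 ω) (x : Site d) :
    ω.expect {x} (siteSpinAt n x 0) =
      ((latticeStagger x * (ω.expect {0} (siteSpinAt n 0 0)).re : ℝ) : ℂ) := by
  obtain ⟨-, hconst⟩ := h.shift_eq_and_stagMagnetisation_eq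
  have him : (ω.expect {x} (siteSpinAt n x 0)).im = 0 :=
    ω.im_expect_eq_zero_of_isHermitian {x} (siteSpin_isHermitian n _ 0)
  have hre : (ω.expect {x} (siteSpinAt n x 0)).re = latticeStagger x * (ω.expect {0} (siteSpinAt n 0 0)).re := by
    have h1 := hconst x 0
    rw [latticeStagger_zero, one_mul] at h1
    rw [← h1, ← mul_assoc, latticeStagger_mul_self, one_mul]
  apply Complex.ext
  · rw [Complex.ofReal_re, hre]
  · rw [Complex.ofReal_im, him]

/-- Thermal twin: `ω(Sˣ_x) = (-1)^x Re ω(Sˣ_0)` as a complex number, for every `x`-sourced infinitesimal-field thermal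
state. [cite: KomaTasaki1993, §1 (1.9)] [cite: BratteliRobinsonI1987, Prop. 2.3.11(a)] -/
theorem IsInfinitesimalFieldThermalState.expect_siteSpinAt_zero_eq_of_zero
    (h : IsInfinitesimalFieldThermalState d n J Δ 0 β ω) (x : Site d) :
    ω.expect {x} (siteSpinAt n x 0) =
      ((latticeStagger x * (ω.expect {0} (siteSpinAt n 0 0)).re : ℝ) : ℂ) := by
  obtain ⟨-, hconst⟩ := h.shift_eq_and_stagMagnetisation_eq
  have him : (ω.expect {x} (siteSpinAt n x 0)).im = 0 :=
    ω.im_expect_eq_zero_of_isHermitian {x} (siteSpin_isHermitian n _ 0)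
  have hre : (ω.expect {x} (siteSpinAt n x 0)).re = latticeStagger x * (ω.expect {0} (siteSpinAt n 0 0)).re := by
    have h1 := hconst x 0
    rw [latticeStagger_zero, one_mul] at h1
    rw [← h1, ← mul_assoc, latticeStagger_mul_self, one_mul]
  apply Complex.ext
  · rw [Complex.ofReal_re, hre]
  · rw [Complex.ofReal_im, him]

end OnePoint

/-! ## §4 The `U(1)` orbit of symmetry-breaking states of the planar antiferromagnet -/

section Orbit

variable {d n : ℕ} {J Δ : ℝ}

/-- **The one-point functions of a uniformly rotated state.**  If `ω'_Λ(A) = ω_Λ(U_{-a} A U_{-a}ᴴ)` and `ω` has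
one-point vector `(ω(Sˣ_x), ω(Sʸ_x), ω(Sᶻ_x)) = (u, 0, 0)`, then `ω'` has `(u cos a, u sin a, 0)` — the rotation of the
order parameter by the angle `a` (KT94: `ω_θ(o¹) = m cos θ`, `ω_θ(o²) = m sin θ`). [cite: KomaTasaki1994, Cor. 2.9] -/
theorem expect_siteSpinAt_of_uniformTwist (a : ℝ) {ω ω' : InfVolState d (n + 1)}
    (htw : ∀ (Λ : Finset (Site d)) (A : Op ↥Λ (n + 1)),
      ω'.expect Λ A = ω.expect Λ (twistOp (fun _ : ↥Λ => -a) * A * (twistOp (fun _ : ↥Λ => -a))ᴴ))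
    (x : Site d) {u : ℂ} (h0 : ω.expect {x} (siteSpinAt n x 0) = u) (h1 : ω.expect {x} (siteSpinAt n x 1) = 0)
    (h2 : ω.expect {x} (siteSpinAt n x 2) = 0) :
    ω'.expect {x} (siteSpinAt n x 0) = (Real.cos a : ℂ) * u ∧ ω'.expect {x} (siteSpinAt n x 1) = (Real.sin a : ℂ) * u ∧
      ω'.expect {x} (siteSpinAt n x 2) = 0 := by
  refine ⟨?_, ?_, ?_⟩
  · rw [htw, siteSpinAt, uniformTwist_conj_siteSpin_zero, map_add, map_smul, map_smul, smul_eq_mul, smul_eq_mul,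
      Real.cos_neg, Real.sin_neg]
    change (Real.cos a : ℂ) * ω.expect {x} (siteSpinAt n x 0) + ((-Real.sin a : ℝ) : ℂ) * ω.expect {x} (siteSpinAt n x 1) = _
    rw [h0, h1, mul_zero, add_zero]
  · rw [htw, siteSpinAt, uniformTwist_conj_siteSpin_one, map_sub, map_smul, map_smul, smul_eq_mul, smul_eq_mul,
      Real.cos_neg, Real.sin_neg]
    change (Real.cos a : ℂ) * ω.expect {x} (siteSpinAt n x 1) - ((-Real.sin a : ℝ) : ℂ) * ω.expect {x} (siteSpinAt n x 0) = _
    rw [h0, h1, mul_zero, zero_sub, Complex.ofReal_neg, neg_mul, neg_neg]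
  · rw [htw, siteSpinAt, uniformTwist_conj_siteSpin_two]
    exact h2

/-- **Equal phases have angles differing by `2πk`**: `e^{ia} = e^{ib} → ∃ k : ℤ, b = a + k·2π`.
[cite: KomaTasaki1994, Cor. 2.9 (`0 ≤ θ < 2π`)] -/
theorem exists_int_of_exp_I_mul_eq {a b : ℝ} (h : Complex.exp (I * a) = Complex.exp (I * b)) :
    ∃ k : ℤ, b = a + k * (2 * Real.pi) := by
  obtain ⟨k, hk⟩ := Complex.exp_eq_exp_iff_exists_int.1 h.symm
  refine ⟨k, ?_⟩
  have him := congrArg Complex.im hk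
  simp only [Complex.mul_im, Complex.ofReal_re, Complex.ofReal_im, Complex.I_re, Complex.I_im, mul_zero, one_mul,
    zero_add, Complex.add_im, Complex.intCast_re, Complex.intCast_im, Complex.re_ofNat, Complex.im_ofNat,
    Complex.mul_re, zero_mul, sub_zero, add_zero, mul_one] at him
  linarith

/-- **Equality of angles modulo `2π` from the rotated order parameter**: for `u ≠ 0`,
`(cos a · u = cos b · u ∧ sin a · u = sin b · u) → ∃ k : ℤ, b = a + k·2π`. [cite: KomaTasaki1994, Cor. 2.9 (`0 ≤ θ < 2π`)] -/
theorem exists_int_of_cos_sin_mul_eq {a b : ℝ} {u : ℂ} (hu : u ≠ 0) (hc : (Real.cos a : ℂ) * u = (Real.cos b : ℂ) * u)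
    (hs : (Real.sin a : ℂ) * u = (Real.sin b : ℂ) * u) : ∃ k : ℤ, b = a + k * (2 * Real.pi) := by
  have hc' : (Real.cos a : ℂ) = Real.cos b := mul_right_cancel₀ hu hc
  have hs' : (Real.sin a : ℂ) = Real.sin b := mul_right_cancel₀ hu hs
  refine exists_int_of_exp_I_mul_eq ?_
  rw [exp_I_mul_ofReal, exp_I_mul_ofReal, hc', hs']

/-- **States rotated by angles differing by `2πk` coincide.** [cite: Tasaki2022, §3.1] -/
theorem expect_uniformTwist_eq_of_int {q : ℕ} {a b : ℝ} (k : ℤ) (hk : b = a + k * (2 * Real.pi))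
    (ω : InfVolState d q) (Λ : Finset (Site d)) (A : Op ↥Λ q) :
    ω.expect Λ (twistOp (fun _ : ↥Λ => -b) * A * (twistOp (fun _ : ↥Λ => -b))ᴴ) =
      ω.expect Λ (twistOp (fun _ : ↥Λ => -a) * A * (twistOp (fun _ : ↥Λ => -a))ᴴ) := by
  rw [hk, show -(a + (k : ℝ) * (2 * Real.pi)) = -a + ((-k : ℤ) : ℝ) * (2 * Real.pi) by push_cast; ring,
    uniformTwist_add_int_mul_two_pi]

/-- **KOMA–TASAKI 1994 COROLLARY 2.9 AT `T = 0` (infinitesimal-field realisation): THE CIRCLE OF SYMMETRY-BREAKING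
INFINITE-VOLUME GROUND STATES OF THE PLANAR XXZ ANTIFERROMAGNET.**  For `d ≥ 2`, `S = n/2 ≥ ½`, `(d, S) ≠ (2, ½)`,
`J > 0`, `0 ≤ Δ ≤ 1` there are `m > 0` and a family `ω_a`, `a ∈ ℝ`, of infinite-volume ground states of
`xxzLatticeInteraction d n J Δ` (Bratteli–Robinson local stability, range `1`) with, at EVERY site `x`,
`ω_a(Sˣ_x) = (-1)^x m cos a`, `ω_a(Sʸ_x) = (-1)^x m sin a`, `ω_a(Sᶻ_x) = 0`,
and `ω_a = ω_b ↔ ∃ k ∈ ℤ, b = a + 2πk`: the staggered planar magnetisation has modulus `m` (`≥ √2σ`, the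
Kennedy–Lieb–Shastry / Koma–Tasaki floor) and points in the direction `a`, every direction occurring — continuous (`U(1)`)
symmetry breaking with a continuum of distinct ground states.  (`ω_0` is the `x`-sourced infinitesimal-field ground state
`lim_{B↓0} lim_Λ`, `ω_a = ω_0 ∘ Ad U_{-a}` its uniform rotation.) [cite: KomaTasaki1994, Cor. 2.9 and after Thm. 2.5]
[cite: KomaTasaki1993, §7 Thm. 7.3, §1 (1.8)–(1.10)] [cite: KennedyLiebShastryJSP1988, Theorem] -/
theorem xxzAF_groundStates_U1Orbit (hd : 2 ≤ d) (hn : 1 ≤ n) (hdn : ¬ (d = 2 ∧ n = 1)) (hJ : 0 < J) (hΔ : 0 ≤ Δ)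
    (hΔ' : Δ ≤ 1) :
    ∃ m : ℝ, 0 < m ∧ ∃ ω : ℝ → InfVolState d (n + 1),
      (∀ a, ω a ∈ groundStates (xxzLatticeInteraction d n J Δ) 1) ∧
      (∀ a (x : Site d),
        (ω a).expect {x} (siteSpinAt n x 0) = ((latticeStagger x * m * Real.cos a : ℝ) : ℂ) ∧
        (ω a).expect {x} (siteSpinAt n x 1) = ((latticeStagger x * m * Real.sin a : ℝ) : ℂ) ∧
        (ω a).expect {x} (siteSpinAt n x 2) = 0) ∧
      ∀ a b, ω a = ω b ↔ ∃ k : ℤ, b = a + k * (2 * Real.pi) := by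
  obtain ⟨σ, hσ, -, hfloor⟩ := xxzAF_infiniteVolume_groundState_spontaneousStaggeredMagnetisation hd hn hdn hJ hΔ hΔ'
  obtain ⟨ω₀, hω₀⟩ := exists_isInfinitesimalFieldGroundState (d := d) (n := n) J Δ 0
  have hex := fun a : ℝ => ω₀.exists_twist (fun _ : Site d => -a)
  choose ω hω using hex
  set m : ℝ := (ω₀.expect {0} (siteSpinAt n 0 0)).re with hm
  have hmpos : 0 < m := by
    have h := hfloor ω₀ hω₀ 0
    rw [latticeStagger_zero, one_mul] at h
    exact lt_of_lt_of_le (mul_pos (Real.sqrt_pos.2 (by norm_num)) hσ) h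
  have hone : ∀ (a : ℝ) (x : Site d),
      (ω a).expect {x} (siteSpinAt n x 0) = (Real.cos a : ℂ) * ((latticeStagger x * m : ℝ) : ℂ) ∧
      (ω a).expect {x} (siteSpinAt n x 1) = (Real.sin a : ℂ) * ((latticeStagger x * m : ℝ) : ℂ) ∧
      (ω a).expect {x} (siteSpinAt n x 2) = 0 := fun a x =>
    expect_siteSpinAt_of_uniformTwist a (hω a) x (hω₀.expect_siteSpinAt_zero_eq_of_zero x)
      (hω₀.expect_siteSpinAt_one_eq_zero_of_zero x) (hω₀.expect_siteSpinAt_two_eq_zero_of_zero x)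
  refine ⟨m, hmpos, ω, fun a => isGroundState_of_uniformTwist (-a) hω₀.isGroundState_xxz (hω a), fun a x => ?_,
    fun a b => ⟨fun hab => ?_, fun ⟨k, hk⟩ => ?_⟩⟩
  · obtain ⟨h0, h1, h2⟩ := hone a x
    refine ⟨?_, ?_, h2⟩
    · rw [h0]; push_cast; ring
    · rw [h1]; push_cast; ring
  · obtain ⟨ha0, ha1, -⟩ := hone a 0
    obtain ⟨hb0, hb1, -⟩ := hone b 0
    rw [hab] at ha0 ha1
    have hu : (((latticeStagger (0 : Site d)) * m : ℝ) : ℂ) ≠ 0 := by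
      rw [latticeStagger_zero, one_mul]
      exact_mod_cast hmpos.ne'
    exact exists_int_of_cos_sin_mul_eq hu (ha0.symm.trans hb0) (ha1.symm.trans hb1)
  · ext Λ A
    rw [hω a, hω b]
    exact (expect_uniformTwist_eq_of_int k hk ω₀ Λ A).symm

/-- **KOMA–TASAKI 1994 COROLLARY 2.9 IN THERMAL EQUILIBRIUM: THE CIRCLE OF SYMMETRY-BREAKING dKMS STATES OF THE PLANAR
XXZ ANTIFERROMAGNET AT LOW TEMPERATURE** (`d ≥ 3`, `S = n/2 ≥ ½`, `J > 0`, `0 ≤ Δ ≤ 1`).  There is `β₀ > 0` such that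
for every `β ≥ β₀` there are `m > 0` and dKMS (energy–entropy balance, Araki–Moriya) states `ω_a`, `a ∈ ℝ`, of
`xxzLatticeInteraction d n J Δ` at `β` with `ω_a(Sˣ_x) = (-1)^x m cos a`, `ω_a(Sʸ_x) = (-1)^x m sin a`, `ω_a(Sᶻ_x) = 0`
at every site and `ω_a = ω_b ↔ b − a ∈ 2πℤ` — spontaneous breaking of the continuous `U(1)` symmetry in equilibrium,
the order parameter taking every direction (Dyson–Lieb–Simon long-range order as input).
[cite: KomaTasaki1994, Cor. 2.9] [cite: KomaTasaki1993, Thm. 2.1, §1 (1.8)–(1.10)] [cite: DysonLiebSimon1978, Thm. 5.1]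
[cite: BratteliRobinsonII1997, §5.3.1] [cite: ArakiMoriya2003, Def 6.3] -/
theorem xxzAF_dKMSStates_U1Orbit (hd : 3 ≤ d) (hn : 1 ≤ n) (hJ : 0 < J) (hΔ : 0 ≤ Δ) (hΔ' : Δ ≤ 1) :
    ∃ β₀ : ℝ, 0 < β₀ ∧ ∀ β : ℝ, β₀ ≤ β → ∃ m : ℝ, 0 < m ∧ ∃ ω : ℝ → InfVolState d (n + 1),
      (∀ a, (ω a).IsDKMSState (xxzLatticeInteraction d n J Δ) 1 β) ∧
      (∀ a (x : Site d),
        (ω a).expect {x} (siteSpinAt n x 0) = ((latticeStagger x * m * Real.cos a : ℝ) : ℂ) ∧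
        (ω a).expect {x} (siteSpinAt n x 1) = ((latticeStagger x * m * Real.sin a : ℝ) : ℂ) ∧
        (ω a).expect {x} (siteSpinAt n x 2) = 0) ∧
      ∀ a b, ω a = ω b ↔ ∃ k : ℤ, b = a + k * (2 * Real.pi) := by
  obtain ⟨β₀, hβ₀, H⟩ := xxzAF_infiniteVolume_spontaneousStaggeredMagnetisation hd hn hJ hΔ hΔ'
  refine ⟨β₀, hβ₀, fun β hβ => ?_⟩
  obtain ⟨σ, hσ, -, hfloor⟩ := H β hβ
  obtain ⟨ω₀, hω₀⟩ := exists_isInfinitesimalFieldThermalState (d := d) (n := n) J Δ 0 β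
  have hex := fun a : ℝ => ω₀.exists_twist (fun _ : Site d => -a)
  choose ω hω using hex
  set m : ℝ := (ω₀.expect {0} (siteSpinAt n 0 0)).re with hm
  have hmpos : 0 < m := by
    have h := hfloor ω₀ hω₀ 0
    rw [latticeStagger_zero, one_mul] at h
    exact lt_of_lt_of_le (mul_pos (Real.sqrt_pos.2 (by norm_num)) hσ) h
  have hone : ∀ (a : ℝ) (x : Site d),
      (ω a).expect {x} (siteSpinAt n x 0) = (Real.cos a : ℂ) * ((latticeStagger x * m : ℝ) : ℂ) ∧
      (ω a).expect {x} (siteSpinAt n x 1) = (Real.sin a : ℂ) * ((latticeStagger x * m : ℝ) : ℂ) ∧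
      (ω a).expect {x} (siteSpinAt n x 2) = 0 := fun a x =>
    expect_siteSpinAt_of_uniformTwist a (hω a) x (hω₀.expect_siteSpinAt_zero_eq_of_zero x)
      (hω₀.expect_siteSpinAt_one_eq_zero_of_zero x) (hω₀.expect_siteSpinAt_two_eq_zero_of_zero x)
  refine ⟨m, hmpos, ω, fun a => isDKMSState_of_uniformTwist (-a) hω₀.isDKMSState_xxz (hω a), fun a x => ?_,
    fun a b => ⟨fun hab => ?_, fun ⟨k, hk⟩ => ?_⟩⟩
  · obtain ⟨h0, h1, h2⟩ := hone a x
    refine ⟨?_, ?_, h2⟩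
    · rw [h0]; push_cast; ring
    · rw [h1]; push_cast; ring
  · obtain ⟨ha0, ha1, -⟩ := hone a 0
    obtain ⟨hb0, hb1, -⟩ := hone b 0
    rw [hab] at ha0 ha1
    have hu : (((latticeStagger (0 : Site d)) * m : ℝ) : ℂ) ≠ 0 := by
      rw [latticeStagger_zero, one_mul]
      exact_mod_cast hmpos.ne'
    exact exists_int_of_cos_sin_mul_eq hu (ha0.symm.trans hb0) (ha1.symm.trans hb1)
  · ext Λ A
    rw [hω a, hω b]
    exact (expect_uniformTwist_eq_of_int k hk ω₀ Λ A).symm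

end Orbit

/-! ## §5 The planar ferromagnet / the interacting hard-core Bose gas: condensates with every phase -/

section Boson

variable {d n : ℕ} {J Δ : ℝ}

/-- **THE CIRCLE OF GROUND STATES OF THE PLANAR-FERROMAGNETIC XXZ MODEL ON `ℤ^d` WITH UNIFORM PLANAR MAGNETISATION**
(`d ≥ 2`, `S = n/2 ≥ ½`, `(d, S) ≠ (2, ½)`, `J < 0`, `-1 ≤ Δ ≤ 0`): `m > 0` and infinite-volume ground states `ω_a`,
`a ∈ ℝ`, of `xxzLatticeInteraction d n J Δ` with `ω_a(Sˣ_x) = m cos a`, `ω_a(Sʸ_x) = m sin a`, `ω_a(Sᶻ_x) = 0` at EVERY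
site (no stagger), `ω_a = ω_b ↔ b − a ∈ 2πℤ`.  (`ω_a` = the uniform rotation by `a` of the Dyson–Lieb–Simon sublattice
half-turn of the antiferromagnet's `x`-sourced infinitesimal-field ground state at `(-J, -Δ)`.)
[cite: KomaTasaki1994, §3.3 and Cor. 2.9] [cite: DysonLiebSimon1978, §2] -/
theorem xxzPlanarFerro_groundStates_U1Orbit (hd : 2 ≤ d) (hn : 1 ≤ n) (hdn : ¬ (d = 2 ∧ n = 1)) (hJ : J < 0)
    (hΔ0 : Δ ≤ 0) (hΔ1 : -1 ≤ Δ) :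
    ∃ m : ℝ, 0 < m ∧ ∃ ω : ℝ → InfVolState d (n + 1),
      (∀ a, ω a ∈ groundStates (xxzLatticeInteraction d n J Δ) 1) ∧
      (∀ a (x : Site d),
        (ω a).expect {x} (siteSpinAt n x 0) = ((m * Real.cos a : ℝ) : ℂ) ∧
        (ω a).expect {x} (siteSpinAt n x 1) = ((m * Real.sin a : ℝ) : ℂ) ∧
        (ω a).expect {x} (siteSpinAt n x 2) = 0) ∧
      ∀ a b, ω a = ω b ↔ ∃ k : ℤ, b = a + k * (2 * Real.pi) := by
  obtain ⟨σ, hσ, -, hfloor⟩ := xxzAF_infiniteVolume_groundState_spontaneousStaggeredMagnetisation hd hn hdn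
    (neg_pos.2 hJ) (neg_nonneg.2 hΔ0) (by linarith : -Δ ≤ 1)
  obtain ⟨ω₀, hω₀⟩ := exists_isInfinitesimalFieldGroundState (d := d) (n := n) (-J) (-Δ) 0
  -- the sublattice half-turn: uniform magnetisation
  obtain ⟨ω₁, hω₁⟩ := ω₀.exists_twist (fun z : Site d => Real.pi * ((1 - latticeStagger z) / 2))
  have hgs₁ : ω₁.IsGroundState (xxzLatticeInteraction d n J Δ) 1 :=
    InfVolState.IsGroundState.of_expect_eq_twist (fun z : Site d => Real.pi * ((1 - latticeStagger z) / 2))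
      (xxzLatticeInteraction_neg_neg_eq_twist_conj (d := d) n J Δ) hω₀.isGroundState_xxz hω₁
  set m : ℝ := (ω₀.expect {0} (siteSpinAt n 0 0)).re with hm
  have hmpos : 0 < m := by
    have h := hfloor ω₀ hω₀ 0
    rw [latticeStagger_zero, one_mul] at h
    exact lt_of_lt_of_le (mul_pos (Real.sqrt_pos.2 (by norm_num)) hσ) h
  have h₁0 : ∀ x : Site d, ω₁.expect {x} (siteSpinAt n x 0) = (m : ℂ) := by
    intro x
    rw [hω₁, siteSpinAt, sublatticeTwist_conj_siteSpin, if_neg (by decide), map_smul, smul_eq_mul]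
    change (latticeStagger x : ℂ) * ω₀.expect {x} (siteSpinAt n x 0) = _
    rw [hω₀.expect_siteSpinAt_zero_eq_of_zero x, ← Complex.ofReal_mul, ← mul_assoc, latticeStagger_mul_self, one_mul]
  have h₁1 : ∀ x : Site d, ω₁.expect {x} (siteSpinAt n x 1) = 0 := by
    intro x
    rw [hω₁, siteSpinAt, sublatticeTwist_conj_siteSpin, if_neg (by decide), map_smul, smul_eq_mul]
    change (latticeStagger x : ℂ) * ω₀.expect {x} (siteSpinAt n x 1) = _
    rw [hω₀.expect_siteSpinAt_one_eq_zero_of_zero x, mul_zero]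
  have h₁2 : ∀ x : Site d, ω₁.expect {x} (siteSpinAt n x 2) = 0 := by
    intro x
    rw [hω₁, siteSpinAt, sublatticeTwist_conj_siteSpin, if_pos rfl, one_smul]
    exact hω₀.expect_siteSpinAt_two_eq_zero_of_zero x
  -- the uniform rotations of `ω₁`
  have hex := fun a : ℝ => ω₁.exists_twist (fun _ : Site d => -a)
  choose ω hω using hex
  have hone : ∀ (a : ℝ) (x : Site d),
      (ω a).expect {x} (siteSpinAt n x 0) = (Real.cos a : ℂ) * (m : ℂ) ∧
      (ω a).expect {x} (siteSpinAt n x 1) = (Real.sin a : ℂ) * (m : ℂ) ∧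
      (ω a).expect {x} (siteSpinAt n x 2) = 0 := fun a x =>
    expect_siteSpinAt_of_uniformTwist a (hω a) x (h₁0 x) (h₁1 x) (h₁2 x)
  refine ⟨m, hmpos, ω, fun a => isGroundState_of_uniformTwist (-a) hgs₁ (hω a), fun a x => ?_,
    fun a b => ⟨fun hab => ?_, fun ⟨k, hk⟩ => ?_⟩⟩
  · obtain ⟨h0, h1, h2⟩ := hone a x
    refine ⟨?_, ?_, h2⟩
    · rw [h0]; push_cast; ring
    · rw [h1]; push_cast; ring
  · obtain ⟨ha0, ha1, -⟩ := hone a 0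
    obtain ⟨hb0, hb1, -⟩ := hone b 0
    rw [hab] at ha0 ha1
    exact exists_int_of_cos_sin_mul_eq (by exact_mod_cast hmpos.ne') (ha0.symm.trans hb0) (ha1.symm.trans hb1)
  · ext Λ A
    rw [hω a, hω b]
    exact (expect_uniformTwist_eq_of_int k hk ω₁ Λ A).symm

/-- **BOSE–EINSTEIN CONDENSATES OF THE INTERACTING HARD-CORE BOSE GAS WITH EVERY CONDENSATE PHASE** (`d ≥ 3`, hopping
`t > 0`, nearest-neighbour repulsion `0 ≤ V ≤ 2t`, particle–hole symmetric chemical potential; the box Hamiltonians of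
`xxzLatticeInteraction d 1 (-2t) (-V/2t)` are the Bose-gas Hamiltonians `Σ_⟨xy⟩[-t(a†_xa_y + h.c.) + V(n_x-½)(n_y-½)]`,
`HardCoreBoson.hamiltonianNN_eq_xxzHamiltonian`): there are `m > 0` and infinite-volume ground states `ω_a`, `a ∈ ℝ`,
with `ω_a(a†_x) = m e^{ia}` and `ω_a(a_x) = m e^{-ia}` at every site (`a†_x = Sˣ_x + iSʸ_x`, `a_x = Sˣ_x − iSʸ_x`,
Matsubara–Matsuda), pairwise distinct modulo `2π` — Koma–Tasaki's «`ω_θ(a†_x) = ω_θ(a_x)^* ≠ 0` … the states `ω_θ` are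
really infinite volume ground states», for the INTERACTING gas. [cite: KomaTasaki1994, §3.3 eq. (3.22), Cor. 2.9]
[cite: MatsubaraMatsuda1956, §2] [cite: AizenmanEtAl2004, §II] -/
theorem hardCoreBosonRepulsion_groundStates_condensatePhase (hd : 3 ≤ d) {t V : ℝ} (ht : 0 < t) (hV0 : 0 ≤ V)
    (hV1 : V ≤ 2 * t) :
    ∃ m : ℝ, 0 < m ∧ ∃ ω : ℝ → InfVolState d 2,
      (∀ a, ω a ∈ groundStates (xxzLatticeInteraction d 1 (-(2 * t)) (-(V / (2 * t)))) 1) ∧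
      (∀ a (x : Site d),
        (ω a).expect {x} (HardCoreBoson.cre (⟨x, mem_singleton_self x⟩ : ↥({x} : Finset (Site d)))) =
          (m : ℂ) * Complex.exp (I * a) ∧
        (ω a).expect {x} (HardCoreBoson.ann (⟨x, mem_singleton_self x⟩ : ↥({x} : Finset (Site d)))) =
          (m : ℂ) * Complex.exp (-(I * a))) ∧
      ∀ a b, ω a = ω b ↔ ∃ k : ℤ, b = a + k * (2 * Real.pi) := by
  have hΔ1 : -1 ≤ -(V / (2 * t)) := by
    rw [neg_le_neg_iff, div_le_one (by positivity)]
    exact hV1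
  obtain ⟨m, hm, ω, hgs, hone, hdist⟩ := xxzPlanarFerro_groundStates_U1Orbit (d := d) (n := 1) (J := -(2 * t))
    (Δ := -(V / (2 * t))) (by omega) le_rfl (by omega) (by linarith) (by rw [neg_nonpos]; positivity) hΔ1
  refine ⟨m, hm, ω, hgs, fun a x => ?_, hdist⟩
  obtain ⟨h0, h1, -⟩ := hone a x
  constructor
  · rw [HardCoreBoson.cre_eq, map_add, map_smul, smul_eq_mul]
    change (ω a).expect {x} (siteSpinAt 1 x 0) + I * (ω a).expect {x} (siteSpinAt 1 x 1) = _
    rw [h0, h1, exp_I_mul_ofReal]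
    push_cast
    ring
  · rw [HardCoreBoson.ann_eq, map_sub, map_smul, smul_eq_mul]
    change (ω a).expect {x} (siteSpinAt 1 x 0) - I * (ω a).expect {x} (siteSpinAt 1 x 1) = _
    rw [h0, h1, exp_neg_I_mul_ofReal]
    push_cast
    ring

/-- **THERMAL EQUILIBRIUM: A CIRCLE OF dKMS STATES OF THE INTERACTING HARD-CORE BOSE GAS WITH NON-ZERO CONDENSATE ORDER
PARAMETER OF EVERY PHASE** (`d ≥ 3`, `t > 0`, `0 ≤ V ≤ 2t`): `β₀ > 0` such that for every `β ≥ β₀` there are `m > 0` and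
dKMS states `ω_a`, `a ∈ ℝ`, of the Bose-gas interaction `xxzLatticeInteraction d 1 (-2t) (-V/2t)` at `β` with
`ω_a(a†_x) = m e^{ia}` at every site, pairwise distinct modulo `2π` (the sublattice half-turn, an automorphism commuting
with nothing but relating the dynamics of `(J, Δ)` and `(-J, -Δ)`, carries the antiferromagnet's circle of dKMS states
to the Bose gas by `IsDKMSState.of_expect_eq_twist`). [cite: KomaTasaki1994, §3.3, Cor. 2.9]
[cite: DysonLiebSimon1978, Thm. 5.1, §2] [cite: ArakiMoriya2003, Def 6.3] [cite: MatsubaraMatsuda1956, §2] -/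
theorem hardCoreBosonRepulsion_dKMSStates_condensatePhase (hd : 3 ≤ d) {t V : ℝ} (ht : 0 < t) (hV0 : 0 ≤ V)
    (hV1 : V ≤ 2 * t) :
    ∃ β₀ : ℝ, 0 < β₀ ∧ ∀ β : ℝ, β₀ ≤ β → ∃ m : ℝ, 0 < m ∧ ∃ ω : ℝ → InfVolState d 2,
      (∀ a, (ω a).IsDKMSState (xxzLatticeInteraction d 1 (-(2 * t)) (-(V / (2 * t)))) 1 β) ∧
      (∀ a (x : Site d),
        (ω a).expect {x} (HardCoreBoson.cre (⟨x, mem_singleton_self x⟩ : ↥({x} : Finset (Site d)))) =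
          (m : ℂ) * Complex.exp (I * a)) ∧
      ∀ a b, ω a = ω b ↔ ∃ k : ℤ, b = a + k * (2 * Real.pi) := by
  have hΔ0 : 0 ≤ V / (2 * t) := by positivity
  have hΔ1 : V / (2 * t) ≤ 1 := by rw [div_le_one (by positivity)]; exact hV1
  obtain ⟨β₀, hβ₀, H⟩ := xxzAF_dKMSStates_U1Orbit (d := d) (n := 1) (J := 2 * t) (Δ := V / (2 * t)) hd le_rfl
    (by positivity) hΔ0 hΔ1
  refine ⟨β₀, hβ₀, fun β hβ => ?_⟩
  obtain ⟨m, hm, ωAF, hkms, hone, hdist⟩ := H β hβ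
  -- the sublattice half-turn of each `ωAF a`
  have hex := fun a : ℝ => (ωAF a).exists_twist (fun z : Site d => Real.pi * ((1 - latticeStagger z) / 2))
  choose ω hω using hex
  have hrel : ∀ Y : Finset (Site d), xxzLatticeInteraction d 1 (2 * t) (V / (2 * t)) Y =
      twistOp (fun z : ↥Y => Real.pi * ((1 - latticeStagger (z : Site d)) / 2)) *
        xxzLatticeInteraction d 1 (-(2 * t)) (-(V / (2 * t))) Y *
        (twistOp (fun z : ↥Y => Real.pi * ((1 - latticeStagger (z : Site d)) / 2)))ᴴ := by
    intro Y
    have h := xxzLatticeInteraction_neg_neg_eq_twist_conj (d := d) 1 (-(2 * t)) (-(V / (2 * t))) Y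
    rwa [neg_neg, neg_neg] at h
  have hsq : ∀ x : Site d, (latticeStagger x : ℂ) ^ 2 = 1 := fun x => by
    rw [sq, ← Complex.ofReal_mul, latticeStagger_mul_self, Complex.ofReal_one]
  have hcre : ∀ (a : ℝ) (x : Site d),
      (ω a).expect {x} (HardCoreBoson.cre (⟨x, mem_singleton_self x⟩ : ↥({x} : Finset (Site d)))) =
        (m : ℂ) * Complex.exp (I * a) := by
    intro a x
    obtain ⟨h0, h1, -⟩ := hone a x
    rw [siteSpinAt] at h0 h1
    have e0 := hω a {x} (siteSpinAt 1 x 0)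
    have e1 := hω a {x} (siteSpinAt 1 x 1)
    rw [siteSpinAt, sublatticeTwist_conj_siteSpin, if_neg (by decide), map_smul, smul_eq_mul] at e0 e1
    rw [HardCoreBoson.cre_eq, map_add, map_smul, smul_eq_mul, e0, e1, h0, h1, exp_I_mul_ofReal]
    push_cast
    linear_combination ((m : ℂ) * (Complex.cos (a : ℂ) + Complex.sin (a : ℂ) * I)) * hsq x
  refine ⟨m, hm, ω, fun a => InfVolState.IsDKMSState.of_expect_eq_twist
    (fun z : Site d => Real.pi * ((1 - latticeStagger z) / 2)) hrel (hkms a) (hω a), hcre,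
    fun a b => ⟨fun hab => ?_, fun hk => ?_⟩⟩
  · have ha := hcre a 0
    rw [hab, hcre b 0] at ha
    exact exists_int_of_exp_I_mul_eq (mul_left_cancel₀ (by exact_mod_cast hm.ne') ha.symm)
  · obtain ⟨k, hk⟩ := hk
    ext Λ A
    rw [hω a, hω b, (hdist a b).2 ⟨k, hk⟩]

/-- **A general sublattice half-turn transfer at `T > 0`**: dKMS states of the XXZ interaction `(J, Δ)` at `β` twist to dKMS
states of `(-J, -Δ)` at `β` (the interactions are related by the Dyson–Lieb–Simon rotation,
`xxzLatticeInteraction_neg_neg_eq_twist_conj`). [cite: DysonLiebSimon1978, §2] [cite: BratteliRobinsonII1997, §5.3.1] -/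
theorem isDKMSState_neg_neg_of_sublatticeTwist {R β : ℝ} {ω ω' : InfVolState d (n + 1)}
    (hω : ω.IsDKMSState (xxzLatticeInteraction d n J Δ) R β)
    (htw : ∀ (Λ : Finset (Site d)) (A : Op ↥Λ (n + 1)),
      ω'.expect Λ A = ω.expect Λ (twistOp (fun z : ↥Λ => Real.pi * ((1 - latticeStagger (z : Site d)) / 2)) * A *
        (twistOp (fun z : ↥Λ => Real.pi * ((1 - latticeStagger (z : Site d)) / 2)))ᴴ)) :
    ω'.IsDKMSState (xxzLatticeInteraction d n (-J) (-Δ)) R β := by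
  have hrel : ∀ Y : Finset (Site d), xxzLatticeInteraction d n J Δ Y =
      twistOp (fun z : ↥Y => Real.pi * ((1 - latticeStagger (z : Site d)) / 2)) *
        xxzLatticeInteraction d n (-J) (-Δ) Y *
        (twistOp (fun z : ↥Y => Real.pi * ((1 - latticeStagger (z : Site d)) / 2)))ᴴ := by
    intro Y
    have h := xxzLatticeInteraction_neg_neg_eq_twist_conj (d := d) n (-J) (-Δ) Y
    rwa [neg_neg, neg_neg] at h
  exact InfVolState.IsDKMSState.of_expect_eq_twist (fun z : Site d => Real.pi * ((1 - latticeStagger z) / 2)) hrel hω htw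

/-- **THE CHECKERBOARD SOLID OF THE STRONGLY REPULSIVE HARD-CORE BOSE GAS IN THERMAL EQUILIBRIUM** — more generally
the planar-ferromagnetic / axially-antiferromagnetic XXZ model `J < 0`, `Δ ≤ -1` (`d ≥ 3`, `S = n/2 ≥ ½`): `β₀ > 0` such
that for every `β ≥ β₀` there are `σ > 0` and a dKMS state `ω` of `xxzLatticeInteraction d n J Δ` at `β` with staggered axial
order `(-1)^x Re ω(Sᶻ_x) ≥ σ` at every site (for bosons, `n_x - ½ = Sᶻ_x`: a density wave), together with its unit
translate, a second, distinct dKMS state (the sublattice half-turn of the antiferromagnet's Néel dKMS state at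
`(-J, -Δ)`; the twist fixes `Sᶻ`). [cite: KomaTasaki1993, §7 Thm. 7.1] [cite: DysonLiebSimon1978, Thm. 5.1, §2]
[cite: ArakiMoriya2003, Def 6.3] -/
theorem xxzPlanarFerro_exists_dKMSState_neelOrder (hd : 3 ≤ d) (hn : 1 ≤ n) (hJ : J < 0) (hΔ : Δ ≤ -1) :
    ∃ β₀ : ℝ, 0 < β₀ ∧ ∀ β : ℝ, β₀ ≤ β → ∃ σ : ℝ, 0 < σ ∧ ∃ ω : InfVolState d (n + 1),
      ω.IsDKMSState (xxzLatticeInteraction d n J Δ) 1 β ∧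
      (∀ x : Site d, σ ≤ latticeStagger x * (ω.expect {x} (siteSpinAt n x 2)).re) ∧
      ∀ i : Fin d, (ω.shift (unitVec i)).IsDKMSState (xxzLatticeInteraction d n J Δ) 1 β ∧ ω.shift (unitVec i) ≠ ω := by
  obtain ⟨β₀, hβ₀, H⟩ := xxzAF_exists_dKMSState_neelOrder hd hn (neg_pos.2 hJ) (by linarith : 1 ≤ -Δ)
  refine ⟨β₀, hβ₀, fun β hβ => ?_⟩
  obtain ⟨σ, hσ, ω₀, hkms₀, -, -, -, hfloor⟩ := H β hβ
  obtain ⟨ω, hω⟩ := ω₀.exists_twist (fun z : Site d => Real.pi * ((1 - latticeStagger z) / 2))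
  have hkms : ω.IsDKMSState (xxzLatticeInteraction d n J Δ) 1 β := by
    have h := isDKMSState_neg_neg_of_sublatticeTwist hkms₀ hω
    rwa [neg_neg, neg_neg] at h
  have hz : ∀ x : Site d, ω.expect {x} (siteSpinAt n x 2) = ω₀.expect {x} (siteSpinAt n x 2) := by
    intro x
    rw [hω, siteSpinAt, sublatticeTwist_conj_siteSpin, if_pos rfl, one_smul]
  have hfl : ∀ x : Site d, σ ≤ latticeStagger x * (ω.expect {x} (siteSpinAt n x 2)).re := fun x => by
    rw [hz]; exact hfloor x
  refine ⟨σ, hσ, ω, hkms, hfl, fun i =>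
    ⟨hkms.shift (isTranslationInvariant_xxzLatticeInteraction n J Δ) _, fun heq => ?_⟩⟩
  have h1 := hfl 0
  have h2 := hfl ((0 : Site d) + unitVec i)
  rw [latticeStagger_add_unitVec, ← InfVolState.shift_expect_siteSpinAt ω (unitVec i) 0 2, heq, neg_mul] at h2
  rw [latticeStagger_zero, one_mul] at h1
  rw [latticeStagger_zero] at h2
  linarith

/-- **THE CHECKERBOARD SOLID OF HARD-CORE BOSONS WITH STRONG NEAREST-NEIGHBOUR REPULSION, IN EQUILIBRIUM** (`d ≥ 3`,
`t > 0`, `V ≥ 2t`): `β₀ > 0` such that for every `β ≥ β₀` the Bose-gas interaction `xxzLatticeInteraction d 1 (-2t) (-V/2t)`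
has a dKMS state at `β` with staggered density `(-1)^x Re ω(n_x - ½) ≥ σ > 0` at every site whose unit translates are
distinct dKMS states — translation symmetry breaking (crystalline order) in thermal equilibrium.
[cite: KomaTasaki1993, §7 Thm. 7.1] [cite: DysonLiebSimon1978, Thm. 5.1] [cite: MatsubaraMatsuda1956, §2] -/
theorem hardCoreBosonRepulsion_exists_dKMSState_solid (hd : 3 ≤ d) {t V : ℝ} (ht : 0 < t) (hV1 : 2 * t ≤ V) :
    ∃ β₀ : ℝ, 0 < β₀ ∧ ∀ β : ℝ, β₀ ≤ β → ∃ σ : ℝ, 0 < σ ∧ ∃ ω : InfVolState d 2,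
      ω.IsDKMSState (xxzLatticeInteraction d 1 (-(2 * t)) (-(V / (2 * t)))) 1 β ∧
      (∀ x : Site d, σ ≤ latticeStagger x * (ω.expect {x} (siteSpinAt 1 x 2)).re) ∧
      ∀ i : Fin d, (ω.shift (unitVec i)).IsDKMSState (xxzLatticeInteraction d 1 (-(2 * t)) (-(V / (2 * t)))) 1 β ∧
        ω.shift (unitVec i) ≠ ω := by
  have hΔ1 : -(V / (2 * t)) ≤ -1 := by
    rw [neg_le_neg_iff, one_le_div (by positivity)]
    exact hV1
  exact xxzPlanarFerro_exists_dKMSState_neelOrder (d := d) (n := 1) (J := -(2 * t)) (Δ := -(V / (2 * t))) hd le_rfl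
    (by linarith) hΔ1

end Boson

end XXZKT

end Literature.MathematicalPhysics.QuantumLattice

end
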